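import Literature.Analysis.FluidPDE.WeakGradientSlicing
import Literature.Analysis.FluidPDE.SereginLocalStokesIntegrabilityGain
import Literature.Analysis.FluidPDE.NSSpinHeatEquationProofs
import Literature.Analysis.FunctionSpaces.MollificationLocal
import Literature.Analysis.FunctionSpaces.MollificationLp
import Literature.Analysis.PDE.CoordWordDeriv
import HarnessLib

/-!
# Slices, word jets of weak derivatives and interior mollification

Analysis/FluidPDE proofs file (theorems only; no definitions, no named facts). Tool kit for the
quantitative higher-regularity bootstrap of essentially bounded Navier–Stokes solutions
(Serrin 1962; Robinson–Rodrigo–Sadowski 2016, Thm. 13.7; Seregin–Šverák 2009, §2 p. 8, the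
named fact `NSBoundedHigherRegularityBounds`). The bootstrap tracks, for a scalar space–time
function `w` on a cylinder, the *word jet* of its weak spatial derivatives
`W v = ∂_{i₁} ⋯ ∂_{i_k} w`, `v = [i₁, …, i_k]` a word in the coordinate directions (head =
outermost derivative, the convention of the tree's `PDE.cwd`), linked by the weak-derivative
identities `∫ W v ∂ᵢΞ = -∫ W (i :: v) Ξ` against test functions. This file proves:

* `SerrinBootstrap.sum_smul_proj_apply` (`_bv`): the covector `Σᵢ cᵢ projᵢ` of a family of
  partial derivatives;
* `SerrinBootstrap.normed_convolution_indicator_apply`, `abs_normed_convolution_indicator_le`,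
  `contDiff_normed_convolution_indicator`: the interior mollification `φ ⋆ 𝟙_U f` of the zero
  extension of a function on an open set, as a set integral, its sup bound and smoothness;
* `SerrinBootstrap.cwd_normed_convolution_indicator_eq` — **mollification intertwines word jets
  and classical word derivatives**: if `J v` has the weak gradient `Σᵢ J (i :: v) projᵢ` on
  `B(c, ρ)` for `|v| < n`, then `∂_v (φ ⋆ 𝟙_B J []) = φ ⋆ 𝟙_B (J v)` on `B(c, ρ - r_φ)` for
  `|v| ≤ n` (Evans, *PDE*, §5.3.1 Thm. 1: `Dᵅu^ε = η_ε ⋆ Dᵅu` on `U_ε`, iterated);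
* `SerrinBootstrap.ae_hasWeakFDerivOn_slice_of_scalar` — **time slices of a scalar space–time
  function with weak spatial partials are weakly differentiable**: scalar form of the accepted
  `HasWeakSpatialGradientOn.ae_hasWeakFDerivOn_slice` (embed `w ↦ w e₀`), and its countable
  version for word jets `ae_forall_hasWeakFDerivOn_slice_of_jet`.

## References

* L. C. Evans, *Partial Differential Equations*, 2nd ed. (2010), §5.2.1, §5.3.1 Thm. 1,
  App. C.4 Thm. 7. [`Evans2010`]
* J. Serrin, Arch. Rational Mech. Anal. 9 (1962) 187–195. [`Serrin1962`]
* J. C. Robinson, J. L. Rodrigo, W. Sadowski, *The Three-Dimensional Navier–Stokes Equations*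
  (CUP 2016), Thm. 13.7, §13.3.2. [`RobinsonRodrigoSadowskiCUP2016`]
-/

noncomputable section

open MeasureTheory Set Function Filter Topology TopologicalSpace Metric ContinuousLinearMap
open scoped NNReal ENNReal RealInnerProductSpace Convolution ContDiff

namespace Literature.Analysis.FluidPDE

namespace SerrinBootstrap

open Literature.Analysis.FunctionSpaces Literature.Analysis.PDE

/-! ### The covector of a family of partial derivatives -/

/-- `(Σᵢ cᵢ projᵢ) v = Σᵢ cᵢ vᵢ`. [folklore] -/
theorem sum_smul_proj_apply (c : Fin 3 → ℝ) (v : EuclideanSpace ℝ (Fin 3)) :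
    (∑ i, c i • (EuclideanSpace.proj i : EuclideanSpace ℝ (Fin 3) →L[ℝ] ℝ)) v = ∑ i, c i * v i := by
  simp

/-- `(Σᵢ cᵢ projᵢ) eⱼ = cⱼ`. [folklore] -/
theorem sum_smul_proj_apply_bv (c : Fin 3 → ℝ) (j : Fin 3) :
    (∑ i, c i • (EuclideanSpace.proj i : EuclideanSpace ℝ (Fin 3) →L[ℝ] ℝ)) (bv j) = c j := by
  rw [sum_smul_proj_apply, bv_eq_single]
  simp [Finset.sum_ite_eq', PiLp.single_apply]

/-! ### Interior mollification of zero extensions -/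

/-- The interior mollification of a zero extension as a set integral:
`(φ ⋆ 𝟙_U f)(x) = ∫_U φ(x - y) f(y) dy`. [folklore] -/
theorem normed_convolution_indicator_apply (φ : ContDiffBump (0 : EuclideanSpace ℝ (Fin 3)))
    {U : Set (EuclideanSpace ℝ (Fin 3))} (hU : MeasurableSet U) (f : EuclideanSpace ℝ (Fin 3) → ℝ)
    (x : EuclideanSpace ℝ (Fin 3)) :
    (φ.normed volume ⋆[lsmul ℝ ℝ, volume] U.indicator f) x =
      ∫ y in U, φ.normed volume (x - y) * f y := by
  rw [convolution_def]
  simp only [lsmul_apply, smul_eq_mul]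
  rw [← integral_sub_left_eq_self (fun t => φ.normed volume t * U.indicator f (x - t)) volume x,
    ← integral_indicator hU]
  congr 1 with y
  simp only [sub_sub_cancel]
  by_cases hy : y ∈ U
  · simp only [indicator_of_mem hy]
  · simp only [indicator_of_notMem hy, mul_zero]

/-- **Sup bound for interior mollifications**: if `|f| ≤ K` a.e. on `U` (`K ≥ 0`) then
`|(φ ⋆ 𝟙_U f)(x)| ≤ K` for every `x`. [folklore] -/
theorem abs_normed_convolution_indicator_le (φ : ContDiffBump (0 : EuclideanSpace ℝ (Fin 3)))
    {U : Set (EuclideanSpace ℝ (Fin 3))} (hU : MeasurableSet U) {f : EuclideanSpace ℝ (Fin 3) → ℝ}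
    {K : ℝ} (hK : 0 ≤ K) (hf : ∀ᵐ y ∂(volume.restrict U), |f y| ≤ K) (x : EuclideanSpace ℝ (Fin 3)) :
    |(φ.normed volume ⋆[lsmul ℝ ℝ, volume] U.indicator f) x| ≤ K := by
  rw [normed_convolution_indicator_apply φ hU f x]
  by_cases hint : Integrable (fun y => φ.normed volume (x - y) * f y) (volume.restrict U)
  · calc |∫ y in U, φ.normed volume (x - y) * f y|
        ≤ ∫ y in U, |φ.normed volume (x - y) * f y| := abs_integral_le_integral_abs
      _ ≤ ∫ y in U, φ.normed volume (x - y) * K := by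
          refine integral_mono_ae hint.abs ?_ ?_
          · exact ((φ.continuous_normed.comp (continuous_const.sub continuous_id)).mul
              continuous_const).integrable_of_hasCompactSupport
              ((φ.hasCompactSupport_normed.comp_homeomorph
                ((Homeomorph.neg _).trans (Homeomorph.addLeft x))).mul_right) |>.integrableOn
          · filter_upwards [hf] with y hy
            rw [abs_mul, abs_of_nonneg (φ.nonneg_normed _)]
            exact mul_le_mul_of_nonneg_left hy (φ.nonneg_normed _)
      _ ≤ ∫ y, φ.normed volume (x - y) * K := by
          refine setIntegral_le_integral ?_ (Eventually.of_forall fun y =>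
            mul_nonneg (φ.nonneg_normed _) hK)
          exact ((φ.continuous_normed.comp (continuous_const.sub continuous_id)).mul
              continuous_const).integrable_of_hasCompactSupport
              ((φ.hasCompactSupport_normed.comp_homeomorph
                ((Homeomorph.neg _).trans (Homeomorph.addLeft x))).mul_right)
      _ = K := by
          rw [integral_mul_const, integral_sub_left_eq_self (φ.normed volume) volume x,
            φ.integral_normed, one_mul]
  · rw [integral_undef hint, abs_zero]; exact hK

/-- Interior mollifications of zero extensions of integrable functions are smooth. [folklore] -/
theorem contDiff_normed_convolution_indicator (φ : ContDiffBump (0 : EuclideanSpace ℝ (Fin 3)))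
    {U : Set (EuclideanSpace ℝ (Fin 3))} (hU : MeasurableSet U) {f : EuclideanSpace ℝ (Fin 3) → ℝ}
    (hf : IntegrableOn f U volume) :
    ContDiff ℝ ∞ (φ.normed volume ⋆[lsmul ℝ ℝ, volume] U.indicator f) :=
  φ.hasCompactSupport_normed.contDiff_convolution_left _ φ.contDiff_normed
    (hf.integrable_indicator hU).locallyIntegrable

/-! ### Mollification intertwines word jets and classical word derivatives -/

/-- Points of the shrunk ball see the whole kernel inside the ball:
`closedBall x r ⊆ ball c ρ` for `x ∈ ball c (ρ - r)`. [folklore] -/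
theorem closedBall_subset_ball_of_mem {c x : EuclideanSpace ℝ (Fin 3)} {ρ r : ℝ}
    (hx : x ∈ ball c (ρ - r)) : closedBall x r ⊆ ball c ρ := by
  intro y hy
  rw [mem_ball] at hx ⊢
  rw [mem_closedBall] at hy
  calc dist y c ≤ dist y x + dist x c := dist_triangle _ _ _
    _ < ρ := by linarith

/-- **Interior mollification intertwines weak word jets and classical word derivatives**
(Evans, *PDE*, §5.3.1, Thm. 1: `Dᵅ u^ε = η_ε ⋆ Dᵅ u` on `U_ε`, iterated along a word). Let
`J v`, `v` a word of length `≤ n`, be integrable functions on `B(c, ρ)` such that for `|v| < n`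
the covector `Σᵢ J (i :: v) projᵢ` is a weak derivative of `J v` on `B(c, ρ)`. Then for every
bump `φ` and every word `|v| ≤ n`, the classical word derivative of the mollified zero
extension of `J []` is the mollified zero extension of `J v` on the shrunk ball:
`∂_v (φ ⋆ 𝟙_B J [])(x) = (φ ⋆ 𝟙_B J v)(x)` for `x ∈ B(c, ρ - r_φ)`. [cite: Evans2010, §5.3.1 Theorem 1] -/
theorem cwd_normed_convolution_indicator_eq {c : EuclideanSpace ℝ (Fin 3)} {ρ : ℝ} {n : ℕ}
    {J : List (Fin 3) → EuclideanSpace ℝ (Fin 3) → ℝ}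
    (hJ : ∀ v : List (Fin 3), v.length < n →
      HasWeakFDerivOn (⟨ball c ρ, isOpen_ball⟩ : Opens (EuclideanSpace ℝ (Fin 3))) volume (J v)
        fun x => ∑ i, J (i :: v) x • (EuclideanSpace.proj i : EuclideanSpace ℝ (Fin 3) →L[ℝ] ℝ))
    (hJi : ∀ v : List (Fin 3), v.length ≤ n → IntegrableOn (J v) (ball c ρ) volume)
    (φ : ContDiffBump (0 : EuclideanSpace ℝ (Fin 3))) :
    ∀ v : List (Fin 3), v.length ≤ n → ∀ x ∈ ball c (ρ - φ.rOut),
      cwd v (φ.normed volume ⋆[lsmul ℝ ℝ, volume] (ball c ρ).indicator (J [])) x =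
        (φ.normed volume ⋆[lsmul ℝ ℝ, volume] (ball c ρ).indicator (J v)) x := by
  intro v
  induction v with
  | nil => intro _ x _; rfl
  | cons i v ih =>
    intro hlen x hx
    have hvn : v.length < n := by simpa using hlen
    have ih' := ih hvn.le
    -- the two functions agree near `x`, hence so do their derivatives
    have hopen : IsOpen (ball c (ρ - φ.rOut)) := isOpen_ball
    have hev : cwd v (φ.normed volume ⋆[lsmul ℝ ℝ, volume] (ball c ρ).indicator (J [])) =ᶠ[𝓝 x]
        (φ.normed volume ⋆[lsmul ℝ ℝ, volume] (ball c ρ).indicator (J v)) :=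
      Filter.eventuallyEq_of_mem (hopen.mem_nhds hx) fun y hy => ih' y hy
    rw [cwd_cons]
    show fderiv ℝ (cwd v (φ.normed volume ⋆[lsmul ℝ ℝ, volume] (ball c ρ).indicator (J []))) x (bv i) = _
    rw [hev.fderiv_eq]
    -- the derivative of the mollification of `J v` is the mollification of its weak gradient
    have hsub : closedBall x φ.rOut ⊆ ball c ρ := closedBall_subset_ball_of_mem hx
    have hgi : IntegrableOn (fun y => ∑ j, J (j :: v) y •
        (EuclideanSpace.proj j : EuclideanSpace ℝ (Fin 3) →L[ℝ] ℝ)) (ball c ρ) volume := by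
      have hj : ∀ j : Fin 3, IntegrableOn (fun y => J (j :: v) y •
          (EuclideanSpace.proj j : EuclideanSpace ℝ (Fin 3) →L[ℝ] ℝ)) (ball c ρ) volume :=
        fun j => (hJi (j :: v) (by simpa using hlen)).smul_const _
      exact integrable_finsetSum Finset.univ
        (f := fun j y => J (j :: v) y • (EuclideanSpace.proj j : EuclideanSpace ℝ (Fin 3) →L[ℝ] ℝ))
        fun j _ => hj j
    have hD := (hJ v hvn).hasFDerivAt_normed_convolution_indicator (hJi v hvn.le) hgi φ
      (x := x) hsub
    have hD' : fderiv ℝ (φ.normed volume ⋆[lsmul ℝ ℝ, volume] (ball c ρ).indicator (J v)) x =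
        ∫ y in ball c ρ, φ.normed volume (x - y) • ∑ j, J (j :: v) y •
          (EuclideanSpace.proj j : EuclideanSpace ℝ (Fin 3) →L[ℝ] ℝ) := hD.fderiv
    rw [hD']
    -- evaluate the covector-valued integral at `bv i`
    have hψ := isTestFunctionOn_normed_comp_sub (μ := (volume : Measure (EuclideanSpace ℝ (Fin 3))))
      (U := (⟨ball c ρ, isOpen_ball⟩ : Opens (EuclideanSpace ℝ (Fin 3)))) φ hsub
    obtain ⟨C, hC⟩ := hψ.contDiff.continuous.bounded_above_of_compact_support hψ.hasCompactSupport
    have hint' : Integrable (fun y => φ.normed volume (x - y) • ∑ j, J (j :: v) y •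
        (EuclideanSpace.proj j : EuclideanSpace ℝ (Fin 3) →L[ℝ] ℝ)) (volume.restrict (ball c ρ)) :=
      hgi.bdd_smul C (hψ.contDiff.continuous.aestronglyMeasurable) (ae_of_all _ hC)
    rw [ContinuousLinearMap.integral_apply hint' (bv i)]
    simp only [_root_.FunLike.coe_smul, Pi.smul_apply, sum_smul_proj_apply_bv, smul_eq_mul]
    rw [normed_convolution_indicator_apply φ measurableSet_ball]

/-! ### Time slices of scalar space–time functions with weak spatial partials -/

/-- Integrability over space–time of a function locally integrable on an open region times a
space–time test function on that region. [folklore] -/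
theorem integrable_mul_test {Q : Opens (ℝ × EuclideanSpace ℝ (Fin 3))}
    {F : ℝ × EuclideanSpace ℝ (Fin 3) → ℝ} (hF : LocallyIntegrableOn F (Q : Set _) volume)
    {Ξ : ℝ → EuclideanSpace ℝ (Fin 3) → ℝ} (hΞ : IsSpaceTimeTestOn Q Ξ) :
    Integrable (fun q : ℝ × EuclideanSpace ℝ (Fin 3) => F q * Ξ q.1 q.2)
      (volume : Measure (ℝ × EuclideanSpace ℝ (Fin 3))) :=
  integrable_mul_of_locallyIntegrableOn (Q := Q) hF (w := uncurry Ξ) hΞ.contDiff.continuous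
    hΞ.hasCompactSupport hΞ.tsupport_subset (fun _ hq => image_eq_zero_of_notMem_tsupport hq)

/-- Integrability over space–time of a function locally integrable on an open region times a
spatial partial derivative of a space–time test function on that region. [folklore] -/
theorem integrable_mul_fderiv_test {Q : Opens (ℝ × EuclideanSpace ℝ (Fin 3))}
    {F : ℝ × EuclideanSpace ℝ (Fin 3) → ℝ} (hF : LocallyIntegrableOn F (Q : Set _) volume)
    {Ξ : ℝ → EuclideanSpace ℝ (Fin 3) → ℝ} (hΞ : IsSpaceTimeTestOn Q Ξ) (v : EuclideanSpace ℝ (Fin 3)) :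
    Integrable (fun q : ℝ × EuclideanSpace ℝ (Fin 3) => F q * fderiv ℝ (Ξ q.1) q.2 v)
      (volume : Measure (ℝ × EuclideanSpace ℝ (Fin 3))) :=
  integrable_mul_test hF (NSSpinHeat.isSpaceTimeTestOn_fderiv_apply hΞ v)

/-- **Time slices of a scalar space–time function with weak spatial partials are weakly
differentiable.** Let `w` and `w'ᵢ` (`i = 1, 2, 3`) be locally integrable on the product region
`]a, b[ × Ω` and suppose `∫∫ w ∂ᵢΞ = -∫∫ w'ᵢ Ξ` for every space–time test function `Ξ` on it.
Then for a.e. `t ∈ ]a, b[` the covector field `Σᵢ w'ᵢ(t, ·) projᵢ` is a weak derivative of the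
slice `w(t, ·)` on `Ω` (scalar form of the accepted
`HasWeakSpatialGradientOn.ae_hasWeakFDerivOn_slice`, obtained by embedding `w ↦ w e₀`;
Evans, *PDE*, §5.9.2). [cite: Evans2010, §5.2.1 and §5.9.2] -/
theorem ae_hasWeakFDerivOn_slice_of_scalar {a b : ℝ} {Ω : Opens (EuclideanSpace ℝ (Fin 3))}
    {w : ℝ × EuclideanSpace ℝ (Fin 3) → ℝ} {w' : Fin 3 → ℝ × EuclideanSpace ℝ (Fin 3) → ℝ}
    (hw : LocallyIntegrableOn w (Ioo a b ×ˢ (Ω : Set (EuclideanSpace ℝ (Fin 3)))) volume)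
    (hw' : ∀ i, LocallyIntegrableOn (w' i) (Ioo a b ×ˢ (Ω : Set (EuclideanSpace ℝ (Fin 3)))) volume)
    (hlink : ∀ i, ∀ Ξ : ℝ → EuclideanSpace ℝ (Fin 3) → ℝ,
      IsSpaceTimeTestOn (⟨Ioo a b ×ˢ (Ω : Set (EuclideanSpace ℝ (Fin 3))), isOpen_Ioo.prod Ω.isOpen⟩ :
        Opens (ℝ × EuclideanSpace ℝ (Fin 3))) Ξ →
      ∫ q, w q * fderiv ℝ (Ξ q.1) q.2 (bv i) = -∫ q, w' i q * Ξ q.1 q.2) :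
    ∀ᵐ t ∂(volume.restrict (Ioo a b)),
      HasWeakFDerivOn Ω volume (fun x => w (t, x))
        fun x => ∑ i, w' i (t, x) • (EuclideanSpace.proj i : EuclideanSpace ℝ (Fin 3) →L[ℝ] ℝ) := by
  set Q : Opens (ℝ × EuclideanSpace ℝ (Fin 3)) :=
    ⟨Ioo a b ×ˢ (Ω : Set (EuclideanSpace ℝ (Fin 3))), isOpen_Ioo.prod Ω.isOpen⟩ with hQ
  set e₀ : EuclideanSpace ℝ (Fin 3) := bv 0 with he₀
  -- the embedded vector field and its gradient
  set uvec : ℝ → EuclideanSpace ℝ (Fin 3) → EuclideanSpace ℝ (Fin 3) := fun t x => w (t, x) • e₀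
    with huvec
  set Gvec : ℝ → EuclideanSpace ℝ (Fin 3) → EuclideanSpace ℝ (Fin 3) →L[ℝ] EuclideanSpace ℝ (Fin 3) :=
    fun t x => ∑ i, w' i (t, x) •
      ((EuclideanSpace.proj i : EuclideanSpace ℝ (Fin 3) →L[ℝ] ℝ).smulRight e₀) with hGvec
  have hGvec_apply : ∀ t x (v : EuclideanSpace ℝ (Fin 3)),
      Gvec t x v = (∑ i, w' i (t, x) * v i) • e₀ := by
    intro t x v
    rw [Finset.sum_smul]
    simp only [hGvec]
    simp only [_root_.FunLike.coe_sum, Finset.sum_apply, _root_.FunLike.coe_smul, Pi.smul_apply,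
      ContinuousLinearMap.smulRight_apply, smul_smul]
    rfl
  have hinner_u : ∀ t x (wv : EuclideanSpace ℝ (Fin 3)), ⟪uvec t x, wv⟫ = w (t, x) * wv 0 := by
    intro t x wv
    simp only [huvec, real_inner_smul_left, he₀, bv_eq_single, EuclideanSpace.inner_single_left,
      map_one, one_mul]
  have hinner_G : ∀ t x (v wv : EuclideanSpace ℝ (Fin 3)),
      ⟪Gvec t x v, wv⟫ = (∑ i, w' i (t, x) * v i) * wv 0 := by
    intro t x v wv
    rw [hGvec_apply]
    simp only [real_inner_smul_left, he₀, bv_eq_single, EuclideanSpace.inner_single_left,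
      map_one, one_mul]
  -- local integrability of the embedded fields
  have hli_u : LocallyIntegrableOn (uncurry uvec) (Q : Set (ℝ × EuclideanSpace ℝ (Fin 3))) volume := by
    rw [locallyIntegrableOn_iff Q.isOpen.isLocallyClosed]
    intro k hkQ hk
    have : uncurry uvec = fun q => w q • e₀ := by funext q; rfl
    rw [this]
    exact (hw.integrableOn_compact_subset hkQ hk).smul_const e₀
  have hli_G : LocallyIntegrableOn (uncurry Gvec) (Q : Set (ℝ × EuclideanSpace ℝ (Fin 3))) volume := by
    rw [locallyIntegrableOn_iff Q.isOpen.isLocallyClosed]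
    intro k hkQ hk
    have : uncurry Gvec = fun q => ∑ i, w' i q •
        ((EuclideanSpace.proj i : EuclideanSpace ℝ (Fin 3) →L[ℝ] ℝ).smulRight e₀) := by
      funext q; rfl
    rw [this]
    exact integrable_finsetSum Finset.univ
      (f := fun i q => w' i q • ((EuclideanSpace.proj i : EuclideanSpace ℝ (Fin 3) →L[ℝ] ℝ).smulRight e₀))
      fun i _ => ((hw' i).integrableOn_compact_subset hkQ hk).smul_const _
  -- the embedded field has the embedded weak spatial gradient
  have hST : HasWeakSpatialGradientOn Q uvec Gvec := by
    refine ⟨hli_u, hli_G, fun φ hφ v wv => ?_⟩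
    -- expand `∂_v φ = Σᵢ vᵢ ∂ᵢ φ`
    have hDφ : ∀ t x, fderiv ℝ (φ t) x v = ∑ i, v i * fderiv ℝ (φ t) x (bv i) := by
      intro t x
      conv_lhs => rw [show v = ∑ i, v i • (bv i : EuclideanSpace ℝ (Fin 3)) by
        simpa [bv_eq_single] using (EuclideanSpace.basisFun (Fin 3) ℝ).sum_repr v |>.symm]
      rw [map_sum]
      simp only [map_smul, smul_eq_mul]
    -- both iterated integrals as product integrals
    have hIL : ∀ i, Integrable (fun q : ℝ × EuclideanSpace ℝ (Fin 3) =>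
        w q * fderiv ℝ (φ q.1) q.2 (bv i)) volume := fun i => integrable_mul_fderiv_test hw hφ (bv i)
    have hIR : ∀ i, Integrable (fun q : ℝ × EuclideanSpace ℝ (Fin 3) => w' i q * φ q.1 q.2) volume :=
      fun i => integrable_mul_test (hw' i) hφ
    have hL : (fun t => ∫ x, fderiv ℝ (φ t) x v * ⟪uvec t x, wv⟫) =
        fun t => ∫ x, ∑ i, (v i * wv 0) * (w (t, x) * fderiv ℝ (φ t) x (bv i)) := by
      funext t; congr 1; funext x
      rw [hinner_u, hDφ, Finset.sum_mul]
      refine Finset.sum_congr rfl fun i _ => ?_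
      ring
    have hR : (fun t => ∫ x, φ t x * ⟪Gvec t x v, wv⟫) =
        fun t => ∫ x, ∑ i, (v i * wv 0) * (w' i (t, x) * φ t x) := by
      funext t; congr 1; funext x
      rw [hinner_G, Finset.sum_mul, Finset.mul_sum]
      refine Finset.sum_congr rfl fun i _ => ?_
      ring
    rw [hL, hR]
    have hIL' : Integrable (fun q : ℝ × EuclideanSpace ℝ (Fin 3) =>
        ∑ i, (v i * wv 0) * (w q * fderiv ℝ (φ q.1) q.2 (bv i))) volume :=
      integrable_finsetSum Finset.univ
        (f := fun i q => (v i * wv 0) * (w q * fderiv ℝ (φ q.1) q.2 (bv i)))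
        fun i _ => (hIL i).const_mul _
    have hIR' : Integrable (fun q : ℝ × EuclideanSpace ℝ (Fin 3) =>
        ∑ i, (v i * wv 0) * (w' i q * φ q.1 q.2)) volume :=
      integrable_finsetSum Finset.univ
        (f := fun i q => (v i * wv 0) * (w' i q * φ q.1 q.2)) fun i _ => (hIR i).const_mul _
    have e1 : ∫ t, ∫ x, ∑ i, (v i * wv 0) * (w (t, x) * fderiv ℝ (φ t) x (bv i)) =
        ∫ q : ℝ × EuclideanSpace ℝ (Fin 3), ∑ i, (v i * wv 0) * (w q * fderiv ℝ (φ q.1) q.2 (bv i)) := by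
      have := hIL'
      rw [Measure.volume_eq_prod] at this ⊢
      exact (integral_prod _ this).symm
    have e2 : ∫ t, ∫ x, ∑ i, (v i * wv 0) * (w' i (t, x) * φ t x) =
        ∫ q : ℝ × EuclideanSpace ℝ (Fin 3), ∑ i, (v i * wv 0) * (w' i q * φ q.1 q.2) := by
      have := hIR'
      rw [Measure.volume_eq_prod] at this ⊢
      exact (integral_prod _ this).symm
    rw [e1, e2, integral_finsetSum _ fun i _ => (hIL i).const_mul _,
      integral_finsetSum _ fun i _ => (hIR i).const_mul _, ← Finset.sum_neg_distrib]
    refine Finset.sum_congr rfl fun i _ => ?_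
    rw [integral_const_mul, integral_const_mul, hlink i φ hφ, mul_neg]
  -- slice, then project back to the scalar
  have hslice := hST.ae_hasWeakFDerivOn_slice
  filter_upwards [hslice] with t ht
  have hproj := hasWeakFDerivOn_clm_apply ht (EuclideanSpace.proj (0 : Fin 3) : EuclideanSpace ℝ (Fin 3) →L[ℝ] ℝ)
  have e1 : (fun x => (EuclideanSpace.proj (0 : Fin 3) : EuclideanSpace ℝ (Fin 3) →L[ℝ] ℝ) (uvec t x)) =
      fun x => w (t, x) := by
    funext x
    simp [huvec, he₀, bv_eq_single]
  have e2 : (fun x => (EuclideanSpace.proj (0 : Fin 3) : EuclideanSpace ℝ (Fin 3) →L[ℝ] ℝ).comp (Gvec t x)) =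
      fun x => ∑ i, w' i (t, x) • (EuclideanSpace.proj i : EuclideanSpace ℝ (Fin 3) →L[ℝ] ℝ) := by
    funext x
    ext v
    rw [ContinuousLinearMap.comp_apply, hGvec_apply, sum_smul_proj_apply]
    simp [he₀, bv_eq_single]
  rw [e1, e2] at hproj
  exact hproj

/-- **Time slices of a word jet.** Let `W v`, `v` a word, be locally integrable scalar functions on
`]a, b[ × Ω` linked by `∫∫ W v ∂ᵢΞ = -∫∫ W (i :: v) Ξ` for all words of length `< n`, all
directions `i` and all space–time test functions `Ξ`. Then for a.e. `t ∈ ]a, b[`, simultaneously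
for all words `|v| < n`, the slice `W v (t, ·)` has the weak derivative
`Σᵢ W (i :: v)(t, ·) projᵢ` on `Ω` (countably many words). [cite: Evans2010, §5.2.1 and §5.9.2] -/
theorem ae_forall_hasWeakFDerivOn_slice_of_jet {a b : ℝ} {Ω : Opens (EuclideanSpace ℝ (Fin 3))}
    {n : ℕ} {W : List (Fin 3) → ℝ × EuclideanSpace ℝ (Fin 3) → ℝ}
    (hW : ∀ v : List (Fin 3), v.length ≤ n →
      LocallyIntegrableOn (W v) (Ioo a b ×ˢ (Ω : Set (EuclideanSpace ℝ (Fin 3)))) volume)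
    (hlink : ∀ v : List (Fin 3), v.length < n → ∀ i, ∀ Ξ : ℝ → EuclideanSpace ℝ (Fin 3) → ℝ,
      IsSpaceTimeTestOn (⟨Ioo a b ×ˢ (Ω : Set (EuclideanSpace ℝ (Fin 3))), isOpen_Ioo.prod Ω.isOpen⟩ :
        Opens (ℝ × EuclideanSpace ℝ (Fin 3))) Ξ →
      ∫ q, W v q * fderiv ℝ (Ξ q.1) q.2 (bv i) = -∫ q, W (i :: v) q * Ξ q.1 q.2) :
    ∀ᵐ t ∂(volume.restrict (Ioo a b)), ∀ v : List (Fin 3), v.length < n →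
      HasWeakFDerivOn Ω volume (fun x => W v (t, x))
        fun x => ∑ i, W (i :: v) (t, x) • (EuclideanSpace.proj i : EuclideanSpace ℝ (Fin 3) →L[ℝ] ℝ) := by
  rw [ae_all_iff]
  intro v
  by_cases hv : v.length < n
  · have h := ae_hasWeakFDerivOn_slice_of_scalar (Ω := Ω) (w := W v) (w' := fun i => W (i :: v))
      (hW v hv.le) (fun i => hW (i :: v) (by simpa using hv)) (hlink v hv)
    filter_upwards [h] with t ht _ using ht
  · exact Eventually.of_forall fun t h => absurd h hv

end SerrinBootstrap

end Literature.Analysis.FluidPDE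

end
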